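import Literature.MathematicalPhysics.KineticTheory.HardSphereMeanCollisionCount
import Summits.AtomisticToContinuum.HydrodynamicLimit.Theorems.JParityClosureOddContactSymmetryGibbsInvariance
import Summits.AtomisticToContinuum.HydrodynamicLimit.Theorems.JParityClosureCollisionTightnessSweptTube
import Summits.AtomisticToContinuum.HydrodynamicLimit.Theorems.JParityClosureCollisionTightnessTorusGibbs
import Summits.AtomisticToContinuum.HydrodynamicLimit.Theorems.RelayRaceLocalityNearConstantShortTimeHLKineticMoments
import HarnessLib

/-!
# Crux `RestartPrinciple` (stmt-AtomisticToContinuum-12503), line `IdeatorFourSketch` — the two hypotheses of the ENERGY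
# reduction of `stub_meanMapRegularity` (stmt-AtomisticToContinuum-15330) HOLD AT CONSTANT PROFILES

Support file (`--supports stmt-AtomisticToContinuum-12503`; registered sub-goals `mmr_energyCollisionFlux_const`,
`mmr_cubicMoment_const`); companion of `…RestartPrincipleMmrFluxConst` (the momentum hypothesis). The reduction
`mmr_energy_of_collisionFlux_of_cubicMoment` (`…RestartPrincipleMmrEnergy`) turns the energy clause of
`ResponseRigidity.MeanMapRegularity` into (i) a mean collision-flux bound for the energy mark `‖vᵢ − v_k‖ (‖vᵢ‖ + ‖v_k‖)` and
(ii) a cubic velocity moment bound under the flow-evolved local Gibbs laws. Both are discharged here where the law is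
invariant — constant profiles `a, θ > 0`, `u`, the homogeneous Gibbs law `G_N = localGibbsLaw σ a u θ N Φ`, every
`0 < σ ≤ 1/2`, every flow, every `N`:
* `mmr_energyCollisionFlux_const` — (i) with `C_E = 160 σ³ M₃`, `e_E = 0`, `M₃ = 1 + 8 (‖u‖⁴ + 15 θ²)` a bound of the Gaussian
  third absolute moment: `localGibbsLaw_lintegral_le_of_le_collisionMarkSum` (Cercignani–Illner–Pulvirenti 1994 App. 4.A) with
  the inputs of the tree (`measurePreserving_flow_localGibbsLaw_const`, `posGibbs_pairEvent_le_five`, `exists_sweptTube`,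
  `volume_setOf_exists_reprSym_add_latticeVec_mem_le`) and the flux integral `∫ ‖w − v‖² (‖v‖ + ‖w‖) ≤ 8 M₃`;
* `mmr_cubicMoment_const` — (ii) with `C₃ = M₃` (`σ ≤ 1/2`): stationarity of `G_N` and the one-particle Gaussian marginal
  (`localGibbsMeasure_rung0_eq_map`).
What remains open for stmt-15330 is (i), (ii) for the NON-constant profiles of the family (non-invariant laws).

References: C. Cercignani, R. Illner, M. Pulvirenti, *The Mathematical Theory of Dilute Gases* (1994) App. 4.A; H. Spohn,
*Large Scale Dynamics of Interacting Particles* (1991) Part I §2.3.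
-/

noncomputable section

namespace Summit.AtomisticToContinuum.HydrodynamicLimit.Theorems.RestartPrinciple.AgeDuhamelForgetting

open scoped BigOperators Topology ENNReal
open MeasureTheory ProbabilityTheory Set Filter
open Literature.MathematicalPhysics.KineticTheory Literature.Analysis.FluidPDE Literature.Analysis.FunctionSpaces
open Summit.AtomisticToContinuum.HydrodynamicLimit.Theorems.NearConstantShortTimeHL

/-! ## Gaussian third moments -/

/-- **Third absolute moment of an isotropic Gaussian on `ℝ³`**: `∫ ‖v‖³ dN(u, θ) ≤ 1 + 8 (‖u‖⁴ + 15 θ²)` (`‖v‖³ ≤ 1 + ‖v‖⁴`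
and the fourth moment bound `integral_norm_pow_four_gaussMeasure_le`). [folklore] -/
theorem mmr_lintegral_norm_pow_three_gaussMeasure_le (u : V3) {θ : ℝ} (hθ : 0 < θ) :
    ∫⁻ v, ENNReal.ofReal (‖v‖ ^ 3) ∂gaussMeasure u θ ≤ ENNReal.ofReal (1 + 8 * (‖u‖ ^ 4 + 15 * θ ^ 2)) := by
  have h4 : Integrable (fun v : V3 => ‖v‖ ^ 4) (gaussMeasure u θ) :=
    (IsGaussian.memLp_id _ 4 (by simp)).integrable_norm_pow (by norm_num)
  have h3 : Integrable (fun v : V3 => ‖v‖ ^ 3) (gaussMeasure u θ) :=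
    (IsGaussian.memLp_id _ 3 (by simp)).integrable_norm_pow (by norm_num)
  have hpt : ∀ v : V3, ‖v‖ ^ 3 ≤ 1 + ‖v‖ ^ 4 := fun v => by
    rcases le_or_gt ‖v‖ 1 with h | h
    · nlinarith [pow_le_one₀ (norm_nonneg v) h (n := 3), pow_nonneg (norm_nonneg v) 4]
    · nlinarith [pow_pos (zero_lt_one.trans h) 3]
  rw [← ofReal_integral_eq_lintegral_ofReal h3 (ae_of_all _ fun v => by positivity)]
  refine ENNReal.ofReal_le_ofReal ?_
  calc ∫ v, ‖v‖ ^ 3 ∂gaussMeasure u θ ≤ ∫ v, (1 + ‖v‖ ^ 4) ∂gaussMeasure u θ :=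
        integral_mono h3 ((integrable_const _).add h4) hpt
    _ = 1 + ∫ v, ‖v‖ ^ 4 ∂gaussMeasure u θ := by
        rw [integral_add (integrable_const _) h4, integral_const, smul_eq_mul, probReal_univ, one_mul]
    _ ≤ 1 + 8 * (‖u‖ ^ 4 + 15 * θ ^ 2) := by linarith [integral_norm_pow_four_gaussMeasure_le u hθ]

/-- **The Gaussian flux integral of the energy mark**: `∫ ‖w − v‖ · (‖v − w‖ (‖v‖ + ‖w‖)) dN(u,θ)(v) dN(u,θ)(w) ≤ 8 M₃`,
`M₃ = 1 + 8 (‖u‖⁴ + 15 θ²)` (`‖v − w‖² (‖v‖ + ‖w‖) ≤ (‖v‖ + ‖w‖)³ ≤ 4 (‖v‖³ + ‖w‖³)`, marginals). [folklore] -/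
theorem mmr_lintegral_energyMark_prod_gaussMeasure_le (u : V3) {θ : ℝ} (hθ : 0 < θ) :
    ∫⁻ p, ENNReal.ofReal ‖p.2 - p.1‖ * ENNReal.ofReal (‖p.1 - p.2‖ * (‖p.1‖ + ‖p.2‖))
        ∂((gaussMeasure u θ).prod (gaussMeasure u θ)) ≤ ENNReal.ofReal (8 * (1 + 8 * (‖u‖ ^ 4 + 15 * θ ^ 2))) := by
  -- adapted from `lintegral_norm_sub_prod_gaussMeasure_le` (`HardSphereMeanCollisionCount`)
  set γ := gaussMeasure u θ with hγ
  set g : V3 → ℝ≥0∞ := fun v => ENNReal.ofReal (4 * ‖v‖ ^ 3) with hg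
  have hgm : Measurable g := by rw [hg]; fun_prop
  have hle : ∀ p : V3 × V3, ENNReal.ofReal ‖p.2 - p.1‖ * ENNReal.ofReal (‖p.1 - p.2‖ * (‖p.1‖ + ‖p.2‖)) ≤ g p.1 + g p.2 := by
    intro p
    rw [hg, ← ENNReal.ofReal_mul (norm_nonneg _), ← ENNReal.ofReal_add (by positivity) (by positivity)]
    refine ENNReal.ofReal_le_ofReal ?_
    have h1 := norm_sub_le p.1 p.2
    have ha := norm_nonneg p.1
    have hb := norm_nonneg p.2
    rw [norm_sub_rev p.2 p.1]
    calc ‖p.1 - p.2‖ * (‖p.1 - p.2‖ * (‖p.1‖ + ‖p.2‖)) ≤ (‖p.1‖ + ‖p.2‖) * ((‖p.1‖ + ‖p.2‖) * (‖p.1‖ + ‖p.2‖)) := by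
          gcongr
      _ ≤ 4 * ‖p.1‖ ^ 3 + 4 * ‖p.2‖ ^ 3 := by
          nlinarith [mul_nonneg (mul_nonneg ha hb) (sq_nonneg (‖p.1‖ - ‖p.2‖)), sq_nonneg (‖p.1‖ - ‖p.2‖),
            mul_nonneg ha (sq_nonneg (‖p.1‖ - ‖p.2‖)), mul_nonneg hb (sq_nonneg (‖p.1‖ - ‖p.2‖))]
  have h1 : ∫⁻ p, g p.1 ∂(γ.prod γ) = ∫⁻ v, g v ∂γ := by
    calc ∫⁻ p, g p.1 ∂(γ.prod γ) = ∫⁻ v, ∫⁻ _w, g v ∂γ ∂γ := lintegral_prod _ (hgm.comp measurable_fst).aemeasurable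
      _ = ∫⁻ v, g v ∂γ := by simp only [lintegral_const, measure_univ, mul_one]
  have h2 : ∫⁻ p, g p.2 ∂(γ.prod γ) = ∫⁻ v, g v ∂γ := by
    calc ∫⁻ p, g p.2 ∂(γ.prod γ) = ∫⁻ _v, ∫⁻ w, g w ∂γ ∂γ := lintegral_prod _ (hgm.comp measurable_snd).aemeasurable
      _ = ∫⁻ v, g v ∂γ := by simp only [lintegral_const, measure_univ, mul_one]
  have h3 : ∫⁻ v, g v ∂γ ≤ ENNReal.ofReal (4 * (1 + 8 * (‖u‖ ^ 4 + 15 * θ ^ 2))) := by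
    have hfun : g = fun v => ENNReal.ofReal 4 * ENNReal.ofReal (‖v‖ ^ 3) :=
      funext fun v => ENNReal.ofReal_mul (by norm_num)
    rw [hfun, lintegral_const_mul _ (by fun_prop), ENNReal.ofReal_mul (by norm_num), hγ]
    exact mul_le_mul' le_rfl (mmr_lintegral_norm_pow_three_gaussMeasure_le u hθ)
  calc ∫⁻ p, ENNReal.ofReal ‖p.2 - p.1‖ * ENNReal.ofReal (‖p.1 - p.2‖ * (‖p.1‖ + ‖p.2‖)) ∂(γ.prod γ)
      ≤ ∫⁻ p, (g p.1 + g p.2) ∂(γ.prod γ) := lintegral_mono hle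
    _ = ∫⁻ v, g v ∂γ + ∫⁻ v, g v ∂γ := by
        rw [lintegral_add_left (show Measurable (fun p : V3 × V3 => g p.1) from hgm.comp measurable_fst), h1, h2]
    _ ≤ ENNReal.ofReal (4 * (1 + 8 * (‖u‖ ^ 4 + 15 * θ ^ 2))) + ENNReal.ofReal (4 * (1 + 8 * (‖u‖ ^ 4 + 15 * θ ^ 2))) :=
        add_le_add h3 h3
    _ = ENNReal.ofReal (8 * (1 + 8 * (‖u‖ ^ 4 + 15 * θ ^ 2))) := by
        rw [← ENNReal.ofReal_add (by positivity) (by positivity)]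
        ring_nf

/-! ## (i) The mean collision flux of the energy mark under `G_N` -/

/-- **The mean collision flux of the energy mark under the homogeneous Gibbs law** (sub-goal `mmr_energyCollisionFlux_const`):
for `0 < σ ≤ 1/2`, constant profiles `a, θ > 0`, `u`, every `N`, every flow and `s > 0`,
`(ε_N/(N+1)) · E_{G_N}[Σ_{collision times r ∈ [0,s]} Σ_{ordered contact pairs (i,k)} ‖vᵢ − v_k‖ (‖vᵢ‖ + ‖v_k‖)] ≤ 160 σ³ M₃ s`,
`M₃ = 1 + 8 (‖u‖⁴ + 15 θ²)` — hypothesis (i) of `mmr_energy_of_collisionFlux_of_cubicMoment` at constant profiles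
(`localGibbsLaw_lintegral_le_of_le_collisionMarkSum`, pair constant `5`, the flux integral of the energy mark,
`(N+1) ε_N³ = σ³`; for `N = 0` the sum is empty). [cite: CIP1994, App. 4.A] -/
theorem mmr_energyCollisionFlux_const : ∀ (σ : ℝ), 0 < σ → σ ≤ 1 / 2 → ∀ (a θ : ℝ) (u : V3), 0 < a → 0 < θ → ∀ (N : ℕ) (Φ : HardSphereFlow (Torus.geometry (Fin 3)) (hsDiameter σ N) (N + 1)) (s : ℝ), 0 < s → ENNReal.ofReal (hsDiameter σ N / ((N + 1 : ℕ) : ℝ)) * ∫⁻ z, (∑ᶠ r ∈ collisionTimes (Torus.geometry (Fin 3)) (hsDiameter σ N) (fun t => Φ.flow t z) ∩ Set.Icc 0 s, ∑ i, ∑ k, (if i ≠ k ∧ ‖(Torus.geometry (Fin 3)).sepVec (Φ.flow r z i).1 (Φ.flow r z k).1‖ = hsDiameter σ N then ENNReal.ofReal (‖(Φ.flow r z i).2 - (Φ.flow r z k).2‖ * (‖(Φ.flow r z i).2‖ + ‖(Φ.flow r z k).2‖)) else 0)) ∂(localGibbsLaw σ (fun _ => a) (fun _ => u) (fun _ =>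 θ) N Φ) ≤ ENNReal.ofReal (160 * σ ^ 3 * (1 + 8 * (‖u‖ ^ 4 + 15 * θ ^ 2)) * s) := by
  intro σ hσ hσ2 a θ u ha hθ N Φ s hs
  classical
  rcases Nat.eq_zero_or_pos N with hN0 | hN
  · subst hN0
    have hzero : ∀ z : Config (0 + 1) (Fin 3) T3,
        (∑ᶠ r ∈ collisionTimes (Torus.geometry (Fin 3)) (hsDiameter σ 0) (fun t => Φ.flow t z) ∩ Set.Icc 0 s,
          ∑ i, ∑ k, (if i ≠ k ∧ ‖(Torus.geometry (Fin 3)).sepVec (Φ.flow r z i).1 (Φ.flow r z k).1‖ = hsDiameter σ 0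
            then ENNReal.ofReal (‖(Φ.flow r z i).2 - (Φ.flow r z k).2‖ * (‖(Φ.flow r z i).2‖ + ‖(Φ.flow r z k).2‖))
            else 0)) = 0 := fun z =>
      finsum_mem_of_eqOn_zero fun r _ =>
        Finset.sum_eq_zero fun i _ => Finset.sum_eq_zero fun k _ => if_neg fun h => h.1 (Fin.ext (by omega))
    simp only [hzero, lintegral_zero, mul_zero, zero_le]
  · have hε : 0 < hsDiameter σ N := hsDiameter_pos hσ N
    have hpair : ∀ i j : Fin (N + 1), i ≠ j → ∀ T : Set T3, MeasurableSet T →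
        posGibbsMeasure (fun _ : T3 => (1 : ℝ)) (hsDiameter σ N) (N + 1) {x | x i - x j ∈ T} ≤ 5 * volume T :=
      fun i j hij T hT => posGibbs_pairEvent_le_five hσ.le hσ2 hN hij hT
    have hlift : ∀ B : Set V3, MeasurableSet B →
        volume {x : T3 | ∃ k : Fin 3 → ℤ, Torus.reprSym x + Torus.latticeVec k ∈ B} ≤ volume B := fun B hB => by
      simpa only [sub_zero] using volume_setOf_exists_reprSym_add_latticeVec_mem_le (0 : T3) hB
    have hbm : Measurable fun p : V3 × V3 => ENNReal.ofReal (‖p.1 - p.2‖ * (‖p.1‖ + ‖p.2‖)) := by fun_prop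
    have hmain := localGibbsLaw_lintegral_le_of_le_collisionMarkSum hσ2 ha hθ u Φ
      (measurePreserving_flow_localGibbsLaw_const σ a θ u N Φ) (Cp := 5) hpair (fun h hh => exists_sweptTube hε hh)
      hlift hs hbm _ (fun z _ => le_rfl)
    have hflux := mmr_lintegral_energyMark_prod_gaussMeasure_le u hθ
    have key : hsDiameter σ N / ((N + 1 : ℕ) : ℝ) *
        (5 * (4 * s * ((N + 1 : ℕ) : ℝ) ^ 2 * hsDiameter σ N ^ 2) * (8 * (1 + 8 * (‖u‖ ^ 4 + 15 * θ ^ 2)))) =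
          160 * σ ^ 3 * (1 + 8 * (‖u‖ ^ 4 + 15 * θ ^ 2)) * s := by
      rw [← succ_mul_hsDiameter_pow_three σ N]
      have hn : ((N + 1 : ℕ) : ℝ) ≠ 0 := by positivity
      field_simp
      ring
    refine (mul_le_mul' le_rfl (hmain.trans (mul_le_mul' le_rfl hflux))).trans (le_of_eq ?_)
    rw [← key, ← ENNReal.ofReal_ofNat 5, ← ENNReal.ofReal_mul (by norm_num),
      ← ENNReal.ofReal_mul (by positivity), ← ENNReal.ofReal_mul (div_nonneg hε.le (Nat.cast_nonneg _))]

/-! ## (ii) The cubic velocity moment under the evolved `G_N` -/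

/-- **The cubic velocity moment under the (evolved) homogeneous Gibbs law** (sub-goal `mmr_cubicMoment_const`): for
`σ ≤ 1/2`, constant profiles `a, θ > 0`, `u`, every `N`, flow `Φ` and time `r`,
`E_{G_N}[(N+1)⁻¹ Σᵢ ‖vᵢ(Φ_r z)‖³] ≤ M₃ = 1 + 8 (‖u‖⁴ + 15 θ²)` — hypothesis (ii) of `mmr_energy_of_collisionFlux_of_cubicMoment` at
constant profiles: `G_N` is invariant under every flow map (`measurePreserving_flow_localGibbsLaw_const`), and under
`G_N = posGibbs ⊗ N(u,θ)^{⊗(N+1)}` (`localGibbsMeasure_rung0_eq_map`) each velocity is `N(u, θ)`-distributed. [folklore] -/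
theorem mmr_cubicMoment_const : ∀ (σ : ℝ), σ ≤ 1 / 2 → ∀ (a θ : ℝ) (u : V3), 0 < a → 0 < θ → ∀ (N : ℕ) (Φ : HardSphereFlow (Torus.geometry (Fin 3)) (hsDiameter σ N) (N + 1)) (r : ℝ), ∫⁻ z, ENNReal.ofReal ((((N + 1 : ℕ) : ℝ))⁻¹ * ∑ i, ‖(Φ.flow r z i).2‖ ^ 3) ∂(localGibbsLaw σ (fun _ => a) (fun _ => u) (fun _ => θ) N Φ) ≤ ENNReal.ofReal (1 + 8 * (‖u‖ ^ 4 + 15 * θ ^ 2)) := by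
  intro σ hσ2 a θ u ha hθ N Φ r
  set P := localGibbsLaw σ (fun _ => a) (fun _ => u) (fun _ => θ) N Φ with hPdef
  set F : Config (N + 1) (Fin 3) T3 → ℝ≥0∞ := fun z => ENNReal.ofReal ((((N + 1 : ℕ) : ℝ))⁻¹ * ∑ i, ‖(z i).2‖ ^ 3)
    with hF
  have hsm : Measurable fun v : Fin (N + 1) → V3 => ∑ i, ENNReal.ofReal (‖v i‖ ^ 3) :=
    Finset.measurable_sum _ fun i _ => ((measurable_pi_apply i).norm.pow_const 3).ennreal_ofReal
  have hFm : Measurable F :=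
    (measurable_const.mul (Finset.measurable_sum _ fun i _ => ((measurable_pi_apply i).snd).norm.pow_const 3)).ennreal_ofReal
  -- stationarity of `G_N`
  have hstat : ∫⁻ z, F (Φ.flow r z) ∂P = ∫⁻ z, F z ∂P :=
    (measurePreserving_flow_localGibbsLaw_const σ a θ u N Φ r).lintegral_comp hFm
  -- the rung-0 disintegration and the one-particle Gaussian marginal
  set Q := posGibbsMeasure (fun _ : T3 => a) (hsDiameter σ N) (N + 1) with hQ
  set Γ : Measure (Fin (N + 1) → V3) := Measure.pi fun _ => gaussMeasure u θ with hΓ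
  haveI : IsProbabilityMeasure Q := isProbabilityMeasure_posGibbsMeasure continuous_const (fun _ => ha) hσ2 N
  haveI : IsProbabilityMeasure Γ := by rw [hΓ]; infer_instance
  have hlaw : P = (Q.prod Γ).map zipConfig := by
    rw [hPdef, localGibbsLaw_eq, localGibbsMeasure_rung0_eq_map σ ha.le hθ u N]
  have hn0 : (0 : ℝ) < ((N + 1 : ℕ) : ℝ) := by positivity
  have hFzip : ∀ pr : (Fin (N + 1) → T3) × (Fin (N + 1) → V3),
      F (zipConfig pr) = ENNReal.ofReal ((((N + 1 : ℕ) : ℝ))⁻¹) * ∑ i, ENNReal.ofReal (‖pr.2 i‖ ^ 3) := by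
    intro pr
    simp only [hF, zipConfig_apply]
    rw [ENNReal.ofReal_mul (inv_nonneg.2 hn0.le), ENNReal.ofReal_sum_of_nonneg fun i _ => by positivity]
  have hmarg : ∀ i : Fin (N + 1), ∫⁻ v, ENNReal.ofReal (‖v i‖ ^ 3) ∂Γ ≤ ENNReal.ofReal (1 + 8 * (‖u‖ ^ 4 + 15 * θ ^ 2)) := by
    intro i
    have h := (measurePreserving_eval (fun _ : Fin (N + 1) => gaussMeasure u θ) i).lintegral_comp
      (show Measurable fun y : V3 => ENNReal.ofReal (‖y‖ ^ 3) by fun_prop)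
    rw [← hΓ] at h
    exact (le_of_eq h).trans (mmr_lintegral_norm_pow_three_gaussMeasure_le u hθ)
  show ∫⁻ z, F (Φ.flow r z) ∂P ≤ _
  rw [hstat, hlaw, lintegral_map hFm measurable_zipConfig]
  simp_rw [hFzip]
  have hsm2 : Measurable fun pr : (Fin (N + 1) → T3) × (Fin (N + 1) → V3) => ∑ i, ENNReal.ofReal (‖pr.2 i‖ ^ 3) :=
    hsm.comp measurable_snd
  rw [lintegral_const_mul _ hsm2, lintegral_prod _ hsm2.aemeasurable]
  simp only [lintegral_const, measure_univ, mul_one]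
  rw [lintegral_finsetSum _ fun i _ => ((measurable_pi_apply i).norm.pow_const 3).ennreal_ofReal]
  calc ENNReal.ofReal ((((N + 1 : ℕ) : ℝ))⁻¹) * ∑ i, ∫⁻ v, ENNReal.ofReal (‖v i‖ ^ 3) ∂Γ
      ≤ ENNReal.ofReal ((((N + 1 : ℕ) : ℝ))⁻¹) * ∑ _i : Fin (N + 1), ENNReal.ofReal (1 + 8 * (‖u‖ ^ 4 + 15 * θ ^ 2)) := by
        gcongr with i
        exact hmarg i
    _ = ENNReal.ofReal (1 + 8 * (‖u‖ ^ 4 + 15 * θ ^ 2)) := by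
        rw [Finset.sum_const, Finset.card_univ, Fintype.card_fin, nsmul_eq_mul, ← mul_assoc,
          ENNReal.ofReal_inv_of_pos hn0, ENNReal.ofReal_natCast, ENNReal.inv_mul_cancel (by positivity)
            (ENNReal.natCast_ne_top _), one_mul]

end Summit.AtomisticToContinuum.HydrodynamicLimit.Theorems.RestartPrinciple.AgeDuhamelForgetting

end
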